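import Literature.Probability.Percolation.RussoFormula
import Literature.Probability.Percolation.SharpnessDCTProofs
import Mathlib.Algebra.Order.BigOperators.Ring.Finset

/-!
# PERSIST (part 1): the covariance form of Russo's formula on the free box

Support lemma for the crux `PercShatteringRace.FreeSusceptibilityPowerSaving` = S(1/2)
(item stmt-CriticalPhenomena-5786), requested by the crux-strategist's census
(`Cruxes/FreeSusceptibilityPowerSaving/STRATEGY-CENSUS.md` §4 S⁺2 / §8 rec. 4).  Part 1 of 2
(part 2: `PercShatteringRaceFreeSusceptibilityPowerSavingPersist.lean`).

Write `Λ = box d R`, `K = Λ.sym2`, `T = K ∩ E(ℤ^d)` (genuine edges), and for `S ⊆ K` the cylinder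
weight `W(S)(q) = ∏_{i ∈ K} weight E S i q` of `Literature.Probability.Percolation.Russo` (it is
`q^{|S|}(1-q)^{|T|-|S|}` for `S ⊆ T` and `0` otherwise, `Persist.cylW_of_subset`,
`Persist.cylW_eq_zero`).  The free susceptibility polynomial is
`χ(q) = Σ_{y ∈ Λ} cylPoly E K {0 ↔ y inside Λ} q = Σ_S W(S) f(S)`, `f(S) = |C_Λ(0)|(S)`.  We prove
the COVARIANCE FORM OF RUSSO'S FORMULA on this finite-dimensional marginal,

  `q(1-q) χ'(q) = Σ_S W(S) (|T ∩ S| - q|T|) f(S)`        (`Persist.deriv_identity`),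

the binomial variance `Σ_S W(S)(|T ∩ S| - q|T|)² = |T| q(1-q)` (`Persist.sum_cylW_variance`), and by
Cauchy–Schwarz the derivative bound

  `(q(1-q))² χ'(q)² ≤ |Λ| · |T| · q(1-q) · χ(q)`   for `q ∈ [0,1]`   (`Persist.deriv_sq_bound`).

No definitions are introduced (local notation only).
-/

namespace Summit.CriticalPhenomena.PercolationContinuityZ3.Theorems

open MeasureTheory
open Literature.Probability.Percolation Literature.Probability.LatticeModels
open Literature.Probability.Percolation.Russo Literature.Probability.Percolation.DCT16
open scoped Classical

noncomputable section

namespace Persist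
/-! ### §1 Binomial weights on a finite set: total mass and variance -/

variable {α : Type*}

/-- `Σ_{S ⊆ T} q^{|S|} (1-q)^{|T|-|S|} = 1` (binomial theorem). -/
theorem binom_sum_one (T : Finset α) (q : ℝ) :
    ∑ S ∈ T.powerset, q ^ S.card * (1 - q) ^ (T.card - S.card) = 1 := by
  rw [Finset.sum_pow_mul_eq_add_pow]
  simp

/-- The binomial variance identity on the subset lattice:
`Σ_{S ⊆ T} q^{|S|}(1-q)^{|T|-|S|} (|S| - q|T|)² = |T| q (1-q)`. -/
theorem binom_variance (T : Finset α) (q : ℝ) :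
    ∑ S ∈ T.powerset, q ^ S.card * (1 - q) ^ (T.card - S.card) *
        ((S.card : ℝ) - q * T.card) ^ 2 = T.card * q * (1 - q) := by
  classical
  induction T using Finset.induction_on with
  | empty => simp
  | @insert a T ha ih =>
    rw [Finset.sum_powerset_insert ha, Finset.card_insert_of_notMem ha]
    have hstep : ∀ S ∈ T.powerset,
        q ^ S.card * (1 - q) ^ (T.card + 1 - S.card) * ((S.card : ℝ) - q * ((T.card + 1 : ℕ) : ℝ)) ^ 2
          + q ^ (insert a S).card * (1 - q) ^ (T.card + 1 - (insert a S).card) *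
              (((insert a S).card : ℝ) - q * ((T.card + 1 : ℕ) : ℝ)) ^ 2
        = q ^ S.card * (1 - q) ^ (T.card - S.card) * ((S.card : ℝ) - q * T.card) ^ 2
          + q * (1 - q) * (q ^ S.card * (1 - q) ^ (T.card - S.card)) := by
      intro S hS
      have hST : S ⊆ T := Finset.mem_powerset.1 hS
      have haS : a ∉ S := fun h => ha (hST h)
      have hcard : S.card ≤ T.card := Finset.card_le_card hST
      rw [Finset.card_insert_of_notMem haS]
      have h1 : T.card + 1 - S.card = (T.card - S.card) + 1 := by omega
      have h2 : T.card + 1 - (S.card + 1) = T.card - S.card := by omega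
      rw [h1, h2, pow_succ, pow_succ]
      push_cast
      ring
    rw [← Finset.sum_add_distrib, Finset.sum_congr rfl hstep, Finset.sum_add_distrib, ih,
      ← Finset.mul_sum, binom_sum_one]
    push_cast
    ring

/-! ### §2 The cylinder weights of the free box -/

variable {d : ℕ} {R : ℕ}

set_option quotPrecheck false

/-- The cylinder weight `W(S)(q) = ∏_{i ∈ Λ.sym2} weight E S i q` of the free box. -/
local notation "𝒲⟦" S ", " q "⟧" =>
  (∏ i ∈ (box d R).sym2, weight (zdGraph d).edgeSet
    ((↑(S : Finset (Sym2 (Site d)))) : Set (Sym2 (Site d))) i (q : ℝ))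

/-- The genuine edges among the pairs of the box: `T = Λ.sym2 ∩ E(ℤ^d)`. -/
local notation "𝒯" => (((box d R).sym2).filter fun e => e ∈ (zdGraph d).edgeSet)

/-- Each one-coordinate weight is non-negative for `q ∈ [0,1]`. -/
theorem weight_nonneg (u S : Set (Sym2 (Site d))) (i : Sym2 (Site d)) {q : ℝ} (hq0 : 0 ≤ q)
    (hq1 : q ≤ 1) : 0 ≤ weight u S i q := by
  unfold weight
  split_ifs <;> linarith

/-- `W(S)(q) ≥ 0` for `q ∈ [0,1]`. -/
theorem cylW_nonneg (S : Finset (Sym2 (Site d))) {q : ℝ} (hq0 : 0 ≤ q) (hq1 : q ≤ 1) :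
    0 ≤ 𝒲⟦S, q⟧ :=
  Finset.prod_nonneg fun i _ => weight_nonneg _ _ i hq0 hq1

/-- A pair of `T` is a pair of the box and an edge of `ℤ^d`. -/
theorem mem_T_iff {e : Sym2 (Site d)} :
    e ∈ 𝒯 ↔ e ∈ (box d R).sym2 ∧ e ∈ (zdGraph d).edgeSet := Finset.mem_filter

/-- `T ⊆ Λ.sym2`. -/
theorem T_subset : 𝒯 ⊆ (box d R).sym2 := Finset.filter_subset _ _

/-- Off `T` the weight of a subset `S ⊆ T` is `1`; on `T` it is `q` or `1 - q`.  Hence for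
`S ⊆ T`: `W(S)(q) = q^{|S|} (1-q)^{|T|-|S|}`. -/
theorem cylW_of_subset {S : Finset (Sym2 (Site d))} (hS : S ⊆ 𝒯) (q : ℝ) :
    𝒲⟦S, q⟧ = q ^ S.card * (1 - q) ^ ((𝒯).card - S.card) := by
  have hsplit := Finset.prod_filter_mul_prod_filter_not (box d R).sym2
    (fun e => e ∈ (zdGraph d).edgeSet)
    (fun i => weight (zdGraph d).edgeSet ((↑S : Set (Sym2 (Site d)))) i q)
  rw [← hsplit]
  have hoff : ∏ i ∈ (box d R).sym2 with ¬ i ∈ (zdGraph d).edgeSet,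
      weight (zdGraph d).edgeSet ((↑S : Set (Sym2 (Site d)))) i q = 1 := by
    refine Finset.prod_eq_one fun i hi => ?_
    have hiu : i ∉ (zdGraph d).edgeSet := (Finset.mem_filter.1 hi).2
    have hiS : i ∉ (↑S : Set (Sym2 (Site d))) := fun h => hiu (mem_T_iff.1 (hS h)).2
    simp [weight, hiu, hiS]
  rw [hoff, mul_one]
  have hon : ∀ i ∈ 𝒯, weight (zdGraph d).edgeSet ((↑S : Set (Sym2 (Site d)))) i q =
      if i ∈ S then q else 1 - q := by
    intro i hi
    have hiu : i ∈ (zdGraph d).edgeSet := (mem_T_iff.1 hi).2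
    by_cases hiS : i ∈ S
    · simp [weight, hiu, hiS]
    · simp [weight, hiu, hiS]
  rw [Finset.prod_congr rfl hon, Finset.prod_ite, Finset.prod_const, Finset.prod_const]
  congr 2
  · rw [Finset.filter_mem_eq_inter, Finset.inter_eq_right.2 hS]
  · rw [Finset.filter_not, Finset.filter_mem_eq_inter, Finset.inter_eq_right.2 hS,
      Finset.card_sdiff_of_subset hS]

/-- For `S ⊆ Λ.sym2` not contained in `T` (i.e. containing a non-edge) the weight vanishes. -/
theorem cylW_eq_zero {S : Finset (Sym2 (Site d))} (hSK : S ⊆ (box d R).sym2) (hS : ¬ S ⊆ 𝒯)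
    (q : ℝ) : 𝒲⟦S, q⟧ = 0 := by
  obtain ⟨i, hiS, hiT⟩ := Finset.not_subset.1 hS
  have hiu : i ∉ (zdGraph d).edgeSet := fun h => hiT (mem_T_iff.2 ⟨hSK hiS, h⟩)
  refine Finset.prod_eq_zero (hSK hiS) ?_
  have hiS' : i ∈ (↑S : Set (Sym2 (Site d))) := hiS
  simp [weight, hiu, hiS']

/-- **Reduction to the genuine edges**: a weighted cylinder sum over all `S ⊆ Λ.sym2` is the
binomial sum over `S ⊆ T`. -/
theorem sum_cylW_eq_sum_binom (h : Finset (Sym2 (Site d)) → ℝ) (q : ℝ) :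
    ∑ S ∈ ((box d R).sym2).powerset, 𝒲⟦S, q⟧ * h S =
      ∑ S ∈ (𝒯).powerset, q ^ S.card * (1 - q) ^ ((𝒯).card - S.card) * h S := by
  have hzero : ∀ S ∈ ((box d R).sym2).powerset, S ∉ (𝒯).powerset → 𝒲⟦S, q⟧ * h S = 0 := by
    intro S hSK hST
    rw [cylW_eq_zero (Finset.mem_powerset.1 hSK) (fun h' => hST (Finset.mem_powerset.2 h')),
      zero_mul]
  rw [← Finset.sum_subset (Finset.powerset_mono.2 T_subset) hzero]
  refine Finset.sum_congr rfl fun S hS => ?_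
  rw [cylW_of_subset (Finset.mem_powerset.1 hS)]

/-- Total mass: `Σ_{S ⊆ Λ.sym2} W(S)(q) = 1`. -/
theorem sum_cylW_one (q : ℝ) : ∑ S ∈ ((box d R).sym2).powerset, 𝒲⟦S, q⟧ = 1 := by
  have h := sum_cylW_eq_sum_binom (d := d) (R := R) (fun _ => 1) q
  simp only [mul_one] at h
  rw [h, binom_sum_one]

/-- Variance: `Σ_{S ⊆ Λ.sym2} W(S)(q) (|T ∩ S| - q|T|)² = |T| q (1-q)`. -/
theorem sum_cylW_variance (q : ℝ) :
    ∑ S ∈ ((box d R).sym2).powerset, 𝒲⟦S, q⟧ *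
        ((((𝒯).filter fun e => e ∈ S).card : ℝ) - q * (𝒯).card) ^ 2 =
      (𝒯).card * q * (1 - q) := by
  rw [sum_cylW_eq_sum_binom, ← binom_variance (𝒯) q]
  refine Finset.sum_congr rfl fun S hS => ?_
  have hST : S ⊆ 𝒯 := Finset.mem_powerset.1 hS
  rw [Finset.filter_mem_eq_inter, Finset.inter_eq_right.2 hST]

/-! ### §3 The covariance form of Russo's formula on the cylinder polynomial -/

/-- The in-box connection events `A_y = {0 ↔ y inside Λ}`. -/
local notation "𝒜⟦" y "⟧" => (openConnIn (↑(box d R) : Set (Site d)) (0 : Site d) y)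

/-- The free susceptibility polynomial `χ(q) = Σ_{y ∈ Λ} cylPoly E Λ.sym2 A_y q`. -/
local notation "χ⟦" q "⟧" =>
  (∑ y ∈ box d R, cylPoly (zdGraph d).edgeSet (box d R).sym2 𝒜⟦y⟧ (q : ℝ))

/-- Its derivative, as delivered by `Russo.hasDerivAt_cylPoly` term by term. -/
local notation "χ'⟦" q "⟧" =>
  (∑ y ∈ box d R, ∑ e ∈ (box d R).sym2, ∑ S ∈ ((box d R).sym2).powerset,
    (if ((↑(S : Finset (Sym2 (Site d)))) : Set (Sym2 (Site d))) ∈ 𝒜⟦y⟧ then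
      (∏ j ∈ ((box d R).sym2).erase e, weight (zdGraph d).edgeSet
        ((↑(S : Finset (Sym2 (Site d)))) : Set (Sym2 (Site d))) j (q : ℝ)) *
        dweight (zdGraph d).edgeSet ((↑(S : Finset (Sym2 (Site d)))) : Set (Sym2 (Site d))) e
     else 0))

/-- The in-box cluster size of `0` in the configuration `S`, `f(S) = #{y ∈ Λ : S ∈ A_y}`, as a
real number. -/
local notation "𝒇⟦" S "⟧" =>
  (∑ y ∈ box d R, (if ((↑(S : Finset (Sym2 (Site d)))) : Set (Sym2 (Site d))) ∈ 𝒜⟦y⟧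
    then (1 : ℝ) else 0))

/-- The centred edge count `g(S) = |T ∩ S| - q|T|`. -/
local notation "𝒈⟦" S ", " q "⟧" =>
  ((((𝒯).filter fun e => e ∈ (S : Finset (Sym2 (Site d)))).card : ℝ) - (q : ℝ) * (𝒯).card)

/-- `χ` is differentiable with derivative `χ'` (sum of `Russo.hasDerivAt_cylPoly`). -/
theorem hasDerivAt_chi (q : ℝ) : HasDerivAt (fun q : ℝ => χ⟦q⟧) (χ'⟦q⟧) q :=
  HasDerivAt.fun_sum fun y _ => hasDerivAt_cylPoly (zdGraph d).edgeSet (box d R).sym2 𝒜⟦y⟧ q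

/-- One coordinate of the derivative, multiplied by `q(1-q)`:
`q(1-q) · (∏_{j ≠ e} weight_j) · dweight_e = W(S) · c_e(S)` with `c_e(S) = 1 - q`, `-q` or `0`
according as `e` is an open edge, a closed edge, or a non-edge. -/
theorem coord_identity (S : Finset (Sym2 (Site d))) {e : Sym2 (Site d)} (he : e ∈ (box d R).sym2)
    (q : ℝ) :
    q * (1 - q) * ((∏ j ∈ ((box d R).sym2).erase e, weight (zdGraph d).edgeSet
        ((↑S : Set (Sym2 (Site d)))) j q) * dweight (zdGraph d).edgeSet (↑S : Set (Sym2 (Site d))) e)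
      = 𝒲⟦S, q⟧ * (if e ∈ (zdGraph d).edgeSet then (if e ∈ S then 1 - q else -q) else 0) := by
  rw [← Finset.mul_prod_erase _ _ he]
  by_cases heu : e ∈ (zdGraph d).edgeSet
  · by_cases heS : e ∈ S
    · have heS' : e ∈ (↑S : Set (Sym2 (Site d))) := heS
      simp [weight, dweight, heu, heS, heS']
      ring
    · have heS' : e ∉ (↑S : Set (Sym2 (Site d))) := heS
      simp [weight, dweight, heu, heS, heS']
      ring
  · have h0 : dweight (zdGraph d).edgeSet (↑S : Set (Sym2 (Site d))) e = 0 := by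
      unfold dweight; simp [heu]
    simp [h0, heu]

/-- Summing the coordinate factors: `Σ_{e ∈ Λ.sym2} c_e(S) = |T ∩ S| - q|T|`. -/
theorem sum_coord (S : Finset (Sym2 (Site d))) (q : ℝ) :
    ∑ e ∈ (box d R).sym2,
        (if e ∈ (zdGraph d).edgeSet then (if e ∈ S then 1 - q else -q) else (0 : ℝ)) = 𝒈⟦S, q⟧ := by
  rw [← Finset.sum_filter, Finset.sum_ite, Finset.sum_const, Finset.sum_const, nsmul_eq_mul,
    nsmul_eq_mul]
  have hcard := Finset.card_filter_add_card_filter_not (s := 𝒯)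
    (p := fun e => e ∈ S)
  have hc : (((𝒯).filter fun e => ¬ e ∈ S).card : ℝ) =
      ((𝒯).card : ℝ) - (((𝒯).filter fun e => e ∈ S).card : ℝ) := by
    rw [eq_sub_iff_add_eq, add_comm]
    exact_mod_cast hcard
  rw [hc]
  ring

/-- **Covariance form of Russo's formula** (finite-dimensional, on the cylinder polynomial):
`q(1-q) χ'(q) = Σ_S W(S) g(S) f(S)`, i.e. `q(1-q) dχ/dq = Cov(|C_Λ(0)|, X)`. -/
theorem deriv_identity (q : ℝ) :
    q * (1 - q) * χ'⟦q⟧ = ∑ S ∈ ((box d R).sym2).powerset, 𝒲⟦S, q⟧ * 𝒈⟦S, q⟧ * 𝒇⟦S⟧ := by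
  -- push `q(1-q)` inside and use the coordinate identity
  have h1 : ∀ y ∈ box d R, q * (1 - q) * ∑ e ∈ (box d R).sym2, ∑ S ∈ ((box d R).sym2).powerset,
      (if ((↑S : Set (Sym2 (Site d)))) ∈ 𝒜⟦y⟧ then
        (∏ j ∈ ((box d R).sym2).erase e, weight (zdGraph d).edgeSet (↑S : Set (Sym2 (Site d))) j q) *
          dweight (zdGraph d).edgeSet (↑S : Set (Sym2 (Site d))) e else 0)
      = ∑ S ∈ ((box d R).sym2).powerset,
          (if ((↑S : Set (Sym2 (Site d)))) ∈ 𝒜⟦y⟧ then 𝒲⟦S, q⟧ * 𝒈⟦S, q⟧ else 0) := by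
    intro y _
    rw [Finset.sum_comm, Finset.mul_sum]
    refine Finset.sum_congr rfl fun S _ => ?_
    split_ifs with hSy
    · rw [Finset.mul_sum, ← sum_coord S q, Finset.mul_sum]
      refine Finset.sum_congr rfl fun e he => ?_
      exact coord_identity S he q
    · simp
  rw [Finset.mul_sum, Finset.sum_congr rfl h1, Finset.sum_comm]
  refine Finset.sum_congr rfl fun S _ => ?_
  rw [Finset.mul_sum]
  refine Finset.sum_congr rfl fun y _ => ?_
  split_ifs <;> simp

/-- The susceptibility polynomial as a weighted cylinder sum: `χ(q) = Σ_S W(S) f(S)`. -/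
theorem chi_eq_sum (q : ℝ) : χ⟦q⟧ = ∑ S ∈ ((box d R).sym2).powerset, 𝒲⟦S, q⟧ * 𝒇⟦S⟧ := by
  simp only [cylPoly]
  rw [Finset.sum_comm]
  refine Finset.sum_congr rfl fun S _ => ?_
  rw [Finset.mul_sum]
  refine Finset.sum_congr rfl fun y _ => ?_
  split_ifs <;> simp

/-- `0 ≤ f(S) ≤ |Λ|`. -/
theorem f_nonneg (S : Finset (Sym2 (Site d))) : 0 ≤ 𝒇⟦S⟧ :=
  Finset.sum_nonneg fun y _ => by split_ifs <;> norm_num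

/-- `f(S) ≤ |Λ|` (the in-box cluster is a subset of the box). -/
theorem f_le (S : Finset (Sym2 (Site d))) : 𝒇⟦S⟧ ≤ (box d R).card := by
  calc 𝒇⟦S⟧ ≤ ∑ _y ∈ box d R, (1 : ℝ) := Finset.sum_le_sum fun y _ => by split_ifs <;> norm_num
    _ = (box d R).card := by simp

/-- **The derivative bound**: `(q(1-q))² χ'(q)² ≤ |Λ| · |T| · q(1-q) · χ(q)` for `q ∈ [0,1]`
(Cauchy–Schwarz with the weights `W(S) ≥ 0`, `f ≤ |Λ|`, and the binomial variance). -/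
theorem deriv_sq_bound {q : ℝ} (hq0 : 0 ≤ q) (hq1 : q ≤ 1) :
    (q * (1 - q)) ^ 2 * (χ'⟦q⟧) ^ 2 ≤ (box d R).card * (𝒯).card * (q * (1 - q)) * χ⟦q⟧ := by
  have hCS := Finset.sum_sq_le_sum_mul_sum_of_sq_le_mul ((box d R).sym2).powerset
    (r := fun S => 𝒲⟦S, q⟧ * 𝒈⟦S, q⟧ * 𝒇⟦S⟧)
    (f := fun S => 𝒲⟦S, q⟧ * 𝒇⟦S⟧ * 𝒇⟦S⟧)
    (g := fun S => 𝒲⟦S, q⟧ * 𝒈⟦S, q⟧ ^ 2)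
    (fun S _ => mul_nonneg (mul_nonneg (cylW_nonneg S hq0 hq1) (f_nonneg S)) (f_nonneg S))
    (fun S _ => mul_nonneg (cylW_nonneg S hq0 hq1) (sq_nonneg _))
    (fun S _ => le_of_eq (by ring))
  have hvar := sum_cylW_variance (d := d) (R := R) q
  have hf2 : ∑ S ∈ ((box d R).sym2).powerset, 𝒲⟦S, q⟧ * 𝒇⟦S⟧ * 𝒇⟦S⟧
      ≤ (box d R).card * χ⟦q⟧ := by
    rw [chi_eq_sum, Finset.mul_sum]
    refine Finset.sum_le_sum fun S _ => ?_
    calc 𝒲⟦S, q⟧ * 𝒇⟦S⟧ * 𝒇⟦S⟧ ≤ 𝒲⟦S, q⟧ * 𝒇⟦S⟧ * (box d R).card :=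
          mul_le_mul_of_nonneg_left (f_le S) (mul_nonneg (cylW_nonneg S hq0 hq1) (f_nonneg S))
      _ = (box d R).card * (𝒲⟦S, q⟧ * 𝒇⟦S⟧) := by ring
  have hg2 : 0 ≤ ∑ S ∈ ((box d R).sym2).powerset, 𝒲⟦S, q⟧ * 𝒈⟦S, q⟧ ^ 2 :=
    Finset.sum_nonneg fun S _ => mul_nonneg (cylW_nonneg S hq0 hq1) (sq_nonneg _)
  calc (q * (1 - q)) ^ 2 * (χ'⟦q⟧) ^ 2 = (q * (1 - q) * χ'⟦q⟧) ^ 2 := by ring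
    _ = (∑ S ∈ ((box d R).sym2).powerset, 𝒲⟦S, q⟧ * 𝒈⟦S, q⟧ * 𝒇⟦S⟧) ^ 2 := by
        rw [deriv_identity]
    _ ≤ (∑ S ∈ ((box d R).sym2).powerset, 𝒲⟦S, q⟧ * 𝒇⟦S⟧ * 𝒇⟦S⟧) *
          ∑ S ∈ ((box d R).sym2).powerset, 𝒲⟦S, q⟧ * 𝒈⟦S, q⟧ ^ 2 := hCS
    _ ≤ ((box d R).card * χ⟦q⟧) * ∑ S ∈ ((box d R).sym2).powerset, 𝒲⟦S, q⟧ * 𝒈⟦S, q⟧ ^ 2 :=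
        mul_le_mul_of_nonneg_right hf2 hg2
    _ = ((box d R).card * χ⟦q⟧) * ((𝒯).card * q * (1 - q)) := by rw [hvar]
    _ = (box d R).card * (𝒯).card * (q * (1 - q)) * χ⟦q⟧ := by ring

end Persist

/-- Registered anchor `stub_persistVariance` of crux stmt-CriticalPhenomena-5786 (PERSIST part 1): the
binomial variance of the open-edge count under the free-box cylinder weights, stated notation-free. -/
theorem stub_persistVariance :
    ∀ (d R : ℕ) (q : ℝ), ∑ S ∈ ((box d R).sym2).powerset, (∏ i ∈ (box d R).sym2, Russo.weight
    (zdGraph d).edgeSet (↑S : Set (Sym2 (Site d))) i q) * ((((((box d R).sym2).filter fun e => e ∈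
    (zdGraph d).edgeSet).filter fun e => e ∈ S).card : ℝ) - q * (((box d R).sym2).filter fun e =>
    e ∈ (zdGraph d).edgeSet).card) ^ 2 = (((box d R).sym2).filter fun e => e ∈ (zdGraph
    d).edgeSet).card * q * (1 - q) :=
  fun _ _ q => Persist.sum_cylW_variance q

end

end Summit.CriticalPhenomena.PercolationContinuityZ3.Theorems
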